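import Mathlib.Analysis.Calculus.ContDiff.Operations
import Mathlib.Analysis.Calculus.Deriv.Comp
import Mathlib.Analysis.Calculus.Deriv.Prod
import Mathlib.Topology.Connected.Basic
import Literature.NumberTheory.Transcendental.SemialgebraicMapsProofs
import Literature.AlgebraicGeometry.Motives.Jacobian
import HarnessLib

/-!
# Real points of Jacobians: the real Abel–Jacobi package (interface)

For a smooth projective geometrically irreducible curve `C` of genus `g` over a subfield
`k ⊆ ℝ` consisting of real algebraic numbers (route use: `k = ℚ`), with a `k`-rational base point
`P₀` and Jacobian `J`, the following objects are classical:

* the compact real Lie groups `J(ℝ) ⊇ J(ℝ)°`; `J(ℝ)°` is a real torus of dimension `g` and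
  `J(ℝ) ≅ (ℝ/ℤ)^g × (ℤ/2)^d` (Gross–Harris 1981, Prop. 1.1);
* the Abel–Jacobi map `φ = f^{P₀} : C → J`, `x ↦ [x − P₀]` (Milne, *Jacobian Varieties*, §2;
  in the tree: `Literature.AlgebraicGeometry.Motives.Jacobian.abelJacobi`), and the summation maps
  `C^d → J`, `(x₁, …, x_d) ↦ Σ φ(xᵢ)`, all defined over `k` (Gross–Harris 1981, §2), hence
  continuous and semialgebraic on real points;
* the `g`-dimensional space of invariant differential forms `ω` on `J` (Serre, *Algebraic Groups
  and Class Fields*, Ch. III no. 11, Prop. 16 and Cor. 1), which are *additive*: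
  `ρ^*ω = pr₁^*ω + pr₂^*ω` for the group law `ρ = pr₁ + pr₂ : J × J → J`, whence
  `(f + g)^*ω = f^*ω + g^*ω` (Serre, Ch. III no. 11, Prop. 17 and its proof);
* **Abel's theorem in differential form**: `ω ↦ φ^*ω` is a bijection from the invariant
  differentials on `J` onto the differentials of the first kind on `C` (Serre, Ch. V no. 10,
  Prop. 5 and Cor. 1; Milne Prop. 2.2; Griffiths–Harris, *Principles*, §2.2).

Real points of a projective `k`-variety form a compact `k`-semialgebraic subset of some `ℝ^N`
(`ℙⁿ(ℝ)` is an affine real algebraic variety, Bochnak–Coste–Roy Thm. 3.4.4), nonsingular real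
points form a `C^∞` (indeed Nash) submanifold (BCR Prop. 3.3.11), and `k`-morphisms induce
`k`-semialgebraic (BCR Def. 2.2.5, Prop. 2.2.7), real-analytic maps on real points; for `k`
algebraic over `ℚ`, `k`-semialgebraic sets are `ℚ`-semialgebraic.

This file provides the **interface** requested by route `AbelContraction` of the summit
`KontsevichZagierPeriods` (items `AbelContractionLemma`, `RealLoopsSpan`): an elementary, embedded
rendering of the data above as subsets of and maps between Euclidean spaces `Fin n → ℝ`, in the
vocabulary of `Literature.ModelTheory.ExponentialFields.IsSemialgebraic` /
`Literature.NumberTheory.Transcendental.IsSemialgebraicMapOn` (coefficient ring `ℚ`) and of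
Mathlib's calculus (`ContDiff`, `HasDerivAt`, 1-forms as `E → E →L[ℝ] ℝ` exactly as in Mathlib's
`curveIntegral`):

* `CompactAbelianNashGroup N g` — a compact `ℚ`-semialgebraic `g`-dimensional `C^∞` submanifold
  `pts ⊆ ℝ^N` with a commutative group law `add/zero/neg` on it which is `ℚ`-semialgebraic and
  `C^∞` at the points of `pts` (as maps of the ambient spaces), together with a frame
  `invForm : Fin g → …` of additive (= translation-invariant) `1`-forms, semialgebraic on `pts`.
  Intended instance: `A(ℝ)`
  for an abelian variety `A` of dimension `g` over a real-algebraic field (Gross–Harris §1).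
* `RealAbelJacobi M N g` — extends it by the curve data: a compact `ℚ`-semialgebraic
  `1`-dimensional submanifold `C ⊆ ℝ^M` (intended: `C(ℝ) ≠ ∅`), a base point, the Abel–Jacobi map
  `aj : ℝ^M → ℝ^N` (`C^∞` at and `ℚ`-semialgebraic on `C`, `aj(C) ⊆ pts`, `aj base = zero`) and the
  forms `curveForm i` on `C` with **Abel's theorem in differential form**
  `aj^*(invForm i) = curveForm i` on tangent vectors of `C` (`invForm_aj`).
* Derived notions: `idComponent` (`= J(ℝ)°`, the connected component of `zero` in `pts`), the
  summation maps `(x₁,…,xₙ) ↦ Σ aj xᵢ` in two shapes — `ajSum n : (Fin n → ℝ^M) → ℝ^N` (tuples of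
  points, for calculus along `n` curves) and `sumMap n : ℝ^(M·n) → ℝ^N` on `powC n = C(ℝ)ⁿ`
  (appended coordinates, the shape of `IsSemialgebraicMapOn`) —, `appendProd` (products of subsets
  of `ℝ^m`, `ℝ^n` inside `ℝ^(m+n)` via `Fin.append`), `tangentVelocities` (velocities of `C¹`
  curves in a subset), `IsSubmanifoldOfDim`.
* Proved API: group-law consequences; `invForm_translate` (translation invariance from
  additivity); `invForm_aj_add`, `invForm_ajSum` (**Abel's theorem pointwise for `n` moving
  points**: `ωᵢ(Σ aj γₗ)(velocity) = Σₗ αᵢ(γₗ)(γₗ′)`); `isSemialgebraicMapOn_sumMap` (**the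
  summation maps are `ℚ`-semialgebraic**, by `IsSemialgebraicMapOn.comp_holds`);
  `isSemialgebraic_singleton_zero` (`{0}` is `ℚ`-semialgebraic, `0` being definable from
  `(pts, add)`); pairing/projection lemmas for semialgebraic maps; `isConnected_idComponent`.

The **construction** is kept separate from the interface (last section of the file, the only
place where scheme theory enters): `RealAbelJacobi.Realization R C P₀ 𝒥` packages how `R`
realises the real points of an actual curve `C : SchemeOver k` (`k ⊆ ℝ`), with base point
`P₀ ∈ C(k)` and Jacobian `𝒥 : Literature.AlgebraicGeometry.Motives.Jacobian C` — topological
embeddings `C(ℝ) ≃ₜ R.C`, `J(ℝ) ≃ₜ R.pts` (strong topology of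
`Literature.AlgebraicGeometry.Motives.AlgPoints`) whose coordinates are regular functions, carrying
Mathlib's group law of `J(ℝ)` to `R.add` and `f^{P₀}` (`Jacobian.abelJacobi`) to `R.aj`, and
making every regular function a `ℚ`-semialgebraic function of the coordinates — and the NAMED FACT
`RealAbelJacobi.exists_realization`: for `k` real-algebraic and `C` smooth projective
geometrically irreducible of dimension `1`, a package `R : RealAbelJacobi M N (dim J)` with a
realization exists (Gross–Harris 1981 §§1–2 with Akbulut–King Prop. 2.4.1, 2.4.3, Serre III.11,
V.10, Milne §2; not proved here).

## Design notes

* Differential identities are stated **on velocities of curves** lying in the sets (the kinematic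
  tangent vectors `tangentVelocities`), which for `C^∞` submanifolds are the tangent spaces; this is
  the form in which they are consumed (integrands `ω(γ t)(γ′ t)` of curve integrals) and it avoids
  any choice of ambient derivative in normal directions. The maps `add`, `neg`, `aj` and the forms
  are maps of the ambient spaces required to be `C^∞` AT the points of the sets (so composites
  along curves in the sets can be differentiated by the chain rule), but only their germs there
  are constrained: a concrete instance may use algebraic formulas that are singular far away, and
  the existence statement may use any smooth extension (Lee, *Introduction to Smooth Manifolds*,
  2nd ed., Lemma 2.26 with Prop. 5.16).
* Semialgebraicity uses coefficients `ℚ`, as everywhere in the Kontsevich–Zagier files; the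
  `1`-forms are required to have `ℚ`-semialgebraic coefficient functions `x ↦ ω x eⱼ` on the sets,
  which is what makes `ω(γ(t))(γ′(t))` a semialgebraic integrand for semialgebraic `γ`.
* The frame condition `invForm_frame` (the `invForm i x`, `i < g`, restrict to a basis of the dual
  of the tangent space at every `x ∈ pts`) pins `g = dim pts`; additivity then makes the
  `invForm i` exactly a basis of the translation-invariant `1`-forms of the Lie group `pts`
  (Serre III.11 Cor. 1 to Prop. 16).
* Group law written additively (`add`, `zero`, `neg`), although Mathlib's group of points
  `A.Points L` of `Literature.AlgebraicGeometry.Motives.AbelianVariety` is multiplicative.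
* Why extrinsic (subsets of `ℝ^n`, ambient maps and forms) rather than Mathlib's `ChartedSpace` /
  `IsManifold`: the consumers are Kontsevich–Zagier period representations, i.e. integrals of
  semialgebraic functions over semialgebraic subsets of `ℝ^d`, and curve integrals of ambient
  `1`-forms (`curveIntegral`); Mathlib has no embedded-submanifold predicate, so the local structure
  is recorded by the elementary `IsSubmanifoldOfDim` (charts with smooth left inverse).

## What is NOT here

* A proof of `exists_realization`, and any identification of `curveForm` with Kähler
  differentials of the scheme `C` (the tree has no evaluation of Kähler differentials on real
  tangent vectors; inside a realization the `invForm i` are automatically a basis of the realified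
  invariant differentials — a continuous isomorphism of Lie groups is analytic — and the
  `curveForm i` their pull-backs, i.e. the realified differentials of the first kind by Serre V.10
  Cor. 1, but this is not a formal statement here); `J(ℝ)° ≅ (ℝ/ℤ)^g` and the component count
  (Gross–Harris Prop. 1.1, 3.2) — theorems about instances, to be vendored as facts when needed;
  semialgebraicity of `idComponent` (BCR Thm. 2.4.5: connected components of semialgebraic sets
  are semialgebraic — not in the tree).

## References

* B. H. Gross, J. Harris, *Real algebraic curves*, Ann. Sci. ÉNS 14 (1981) 157–182,
  doi:10.24033/asens.1401: §1 Prop. 1.1, §2 (p. 159). [GrossHarris1981]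
* J.-P. Serre, *Algebraic Groups and Class Fields*, GTM 117, Springer 1988: Ch. III no. 11
  (Prop. 16, Cor. 1, Prop. 17), Ch. V no. 10 (Prop. 5, Cor. 1). [Serre1988]
* J. S. Milne, *Jacobian Varieties*, in Cornell–Silverman (1986): §2, Prop. 2.2.
  [Milne1986JacobianVarieties]
* P. Griffiths, J. Harris, *Principles of Algebraic Geometry* (1978), §2.2 (Abel's theorem).
  [GriffithsHarrisPrinciples1978]
* J. Bochnak, M. Coste, M.-F. Roy, *Real Algebraic Geometry* (1998), Def. 2.2.5, Prop. 2.2.7,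
  Thm. 2.4.5, Prop. 3.3.11, Thm. 3.4.4. [BochnakCosteRoy1998]
* S. Akbulut, H. King, *Topology of Real Algebraic Sets*, MSRI Publ. 25, Springer 1992: Ch. II
  §4, Prop. 2.4.1, Cor. 2.4.2 (`ℝPⁿ ≅ G(n+1,1) ⊂ ℝ^{(n+1)²}`, projective real algebraic sets are
  affine), Prop. 2.4.3 (tangent planes of `Nonsing V` vary regularly). [AkbulutKing1992]
* J. M. Lee, *Introduction to Smooth Manifolds*, 2nd ed. (2013), Lemma 2.26 (extension lemma).
  [LeeSmoothManifolds2013]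
-/

noncomputable section

open scoped ContDiff Topology
open Set Filter

namespace Literature.AlgebraicGeometry.RealAlgebraic

open Literature.ModelTheory.ExponentialFields Literature.NumberTheory.Transcendental

/-! ### Elementary vocabulary: products, velocities, submanifolds -/

section Vocabulary

variable {m n : ℕ}

/-- The product `S × T ⊆ ℝ^(m+n)` of `S ⊆ ℝ^m` and `T ⊆ ℝ^n`, in the coordinates of `Fin.append`:
`z ∈ appendProd S T ↔ (z ∘ castAdd) ∈ S ∧ (z ∘ natAdd) ∈ T` (the convention of
`Literature.NumberTheory.Transcendental.IsSemialgebraicMapOn`). [folklore] -/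
def appendProd (S : Set (Fin m → ℝ)) (T : Set (Fin n → ℝ)) : Set (Fin (m + n) → ℝ) :=
  {z | (fun i => z (Fin.castAdd n i)) ∈ S ∧ (fun j => z (Fin.natAdd m j)) ∈ T}

/-- `Fin.append x y ∈ appendProd S T ↔ x ∈ S ∧ y ∈ T`. [folklore] -/
@[simp] theorem append_mem_appendProd {S : Set (Fin m → ℝ)} {T : Set (Fin n → ℝ)}
    {x : Fin m → ℝ} {y : Fin n → ℝ} :
    Fin.append x y ∈ appendProd S T ↔ x ∈ S ∧ y ∈ T := by
  simp [appendProd]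

/-- Membership in `appendProd`, unfolded. [folklore] -/
theorem mem_appendProd {S : Set (Fin m → ℝ)} {T : Set (Fin n → ℝ)} {z : Fin (m + n) → ℝ} :
    z ∈ appendProd S T ↔
      (fun i => z (Fin.castAdd n i)) ∈ S ∧ (fun j => z (Fin.natAdd m j)) ∈ T :=
  Iff.rfl

/-- Products of `ℚ`-semialgebraic sets are `ℚ`-semialgebraic: `appendProd S T` is the intersection
of the preimages of `S` and `T` under the two coordinate projections (cf.
`Literature.ModelTheory.ExponentialFields.IsSemialgebraic.prod_holds`). [cite: BochnakCosteRoy1998, §2.1 (products, after Def. 2.1.4)] -/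
theorem isSemialgebraic_appendProd {S : Set (Fin m → ℝ)} {T : Set (Fin n → ℝ)}
    (hS : IsSemialgebraic ℚ S) (hT : IsSemialgebraic ℚ T) : IsSemialgebraic ℚ (appendProd S T) :=
  (hS.preimage_comp (Fin.castAdd n)).inter (hT.preimage_comp (Fin.natAdd m))

/-- The left block projection `ℝ^(m+n) → ℝ^m`, `z ↦ (zᵢ)_{i<m}`, is a `ℚ`-semialgebraic map on every
`ℚ`-semialgebraic set (a coordinate, hence polynomial, map). [cite: BochnakCosteRoy1998, §2.2 (after Def. 2.2.5)] -/
theorem isSemialgebraicMapOn_castAdd {s : Set (Fin (m + n) → ℝ)} (hs : IsSemialgebraic ℚ s) :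
    IsSemialgebraicMapOn ℚ s (fun z (i : Fin m) => z (Fin.castAdd n i)) := by
  convert isSemialgebraicMapOn_aeval hs (fun i : Fin m => (MvPolynomial.X (Fin.castAdd n i) :
    MvPolynomial (Fin (m + n)) ℚ)) using 2 with z
  funext i
  simp

/-- The right block projection `ℝ^(m+n) → ℝ^n`, `z ↦ (z_{m+j})_{j<n}`, is a `ℚ`-semialgebraic map on
every `ℚ`-semialgebraic set. [cite: BochnakCosteRoy1998, §2.2 (after Def. 2.2.5)] -/
theorem isSemialgebraicMapOn_natAdd {s : Set (Fin (m + n) → ℝ)} (hs : IsSemialgebraic ℚ s) :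
    IsSemialgebraicMapOn ℚ s (fun z (j : Fin n) => z (Fin.natAdd m j)) := by
  convert isSemialgebraicMapOn_aeval hs (fun j : Fin n => (MvPolynomial.X (Fin.natAdd m j) :
    MvPolynomial (Fin (m + n)) ℚ)) using 2 with z
  funext j
  simp

/-- **Pairing of semialgebraic maps.** If `f : s → ℝ^a` and `h : s → ℝ^b` are `ℚ`-semialgebraic maps
on `s ⊆ ℝ^m`, so is `x ↦ (f x, h x) : s → ℝ^(a+b)` (coordinatewise, via
`isSemialgebraicMapOn_iff_forall_holds`; over `ℝ`). [cite: BochnakCosteRoy1998, Prop. 2.2.6] -/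
theorem _root_.Literature.NumberTheory.Transcendental.IsSemialgebraicMapOn.append {a b : ℕ} {s : Set (Fin m → ℝ)} {f : (Fin m → ℝ) → (Fin a → ℝ)}
    {h : (Fin m → ℝ) → (Fin b → ℝ)} (hf : IsSemialgebraicMapOn ℚ s f) (hh : IsSemialgebraicMapOn ℚ s h) :
    IsSemialgebraicMapOn ℚ s (fun x => Fin.append (f x) (h x)) := by
  have hs : IsSemialgebraic ℚ s := IsSemialgebraicMapOn.isSemialgebraic_holds hf
  have hf' := (isSemialgebraicMapOn_iff_forall_holds hs).mp hf
  have hh' := (isSemialgebraicMapOn_iff_forall_holds hs).mp hh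
  refine (isSemialgebraicMapOn_iff_forall_holds hs).mpr fun l => ?_
  refine Fin.addCases (motive := fun l => IsSemialgebraicFunOn ℚ s fun x => Fin.append (f x) (h x) l)
    (fun i => ?_) (fun j => ?_) l
  · simpa only [Fin.append_left] using hf' i
  · simpa only [Fin.append_right] using hh' j

variable {E : Type*} [NormedAddCommGroup E] [NormedSpace ℝ E]

/-- The **kinematic tangent vectors** of a subset `S ⊆ E` at `x`: velocities `γ′(0)` of curves
`γ : ℝ → E` with `γ(0) = x`, differentiable at `0` and lying in `S` for all times near `0`. For a
`C¹` submanifold this is the tangent space `T_x S`. [folklore] -/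
def tangentVelocities (S : Set E) (x : E) : Set E :=
  {v | ∃ γ : ℝ → E, (∀ᶠ s in 𝓝 (0 : ℝ), γ s ∈ S) ∧ γ 0 = x ∧ HasDerivAt γ v 0}

/-- The zero vector is a tangent velocity at every point of `S` (constant curve). [folklore] -/
theorem zero_mem_tangentVelocities {S : Set E} {x : E} (hx : x ∈ S) :
    (0 : E) ∈ tangentVelocities S x :=
  ⟨fun _ => x, Eventually.of_forall fun _ => hx, rfl, hasDerivAt_const 0 x⟩

/-- Tangent velocities are monotone in the set. [folklore] -/
theorem tangentVelocities_mono {S T : Set E} (h : S ⊆ T) (x : E) :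
    tangentVelocities S x ⊆ tangentVelocities T x := by
  rintro v ⟨γ, hγ, h0, hd⟩
  exact ⟨γ, hγ.mono fun s hs => h hs, h0, hd⟩

/-- `S ⊆ ℝ^n` is a **`d`-dimensional embedded `C^∞` submanifold**: every point of `S` has an open
neighbourhood `U` in which `S` is the image of the open unit ball `B` of `ℝ^d` under a map `φ`,
`C^∞` on `B`, admitting a left inverse `ψ` which is `C^∞` on `U` (so `φ|_B` is an injective
immersion and a homeomorphism onto `S ∩ U`; e.g. `S` is locally a graph over a coordinate
`d`-plane and `ψ` the projection). Equivalent to the local `d`-slice condition (Lee,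
*Introduction to Smooth Manifolds*, 2nd ed., Thm. 5.8 and Prop. 5.16). [folklore] -/
def IsSubmanifoldOfDim (d : ℕ) (S : Set (Fin n → ℝ)) : Prop :=
  ∀ x ∈ S, ∃ (U : Set (Fin n → ℝ)) (φ : (Fin d → ℝ) → (Fin n → ℝ)) (ψ : (Fin n → ℝ) → (Fin d → ℝ)),
    IsOpen U ∧ x ∈ U ∧ ContDiffOn ℝ ∞ φ (Metric.ball 0 1) ∧ ContDiffOn ℝ ∞ ψ U ∧
      (∀ t ∈ Metric.ball (0 : Fin d → ℝ) 1, ψ (φ t) = t) ∧ φ '' Metric.ball 0 1 = S ∩ U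

end Vocabulary

/-! ### Compact abelian Nash groups with an invariant coframe (model of `A(ℝ)`) -/

/-- A **compact abelian Nash group of dimension `g` in `ℝ^N` with an invariant coframe** — the
elementary shape of the real points `A(ℝ)` of a `g`-dimensional abelian variety `A` over a
real-algebraic field, embedded in affine space (Gross–Harris 1981, §1; BCR Thm. 3.4.4,
Prop. 3.3.11): a compact `ℚ`-semialgebraic `g`-dimensional `C^∞` submanifold `pts ⊆ ℝ^N`; a
commutative group law `add`, `zero`, `neg` on `pts`, given by maps of the ambient space which are
`C^∞` at the points of `pts × pts`, resp. `pts`, and `ℚ`-semialgebraic there; and `g` `1`-forms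
`invForm i` on `ℝ^N`, `C^∞` at the points of `pts` and with `ℚ`-semialgebraic coefficients on
`pts`, which are **additive** along the
group law on tangent vectors of `pts` — `ρ^*ω = pr₁^*ω + pr₂^*ω` for `ρ = add` (Serre 1988,
Ch. III no. 11, Prop. 17, proof) — and restrict at every point of `pts` to a basis of the dual of
the tangent space (an invariant coframe, Serre III.11, Cor. 1 to Prop. 16). Only the germs of
`add`, `neg`, `invForm` at `pts` are constrained; away from `pts` they are arbitrary extensions.
[cite: GrossHarris1981, §1 Prop. 1.1] [cite: Serre1988, Ch. III no. 11, Prop. 16 Cor. 1 and Prop. 17] -/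
structure CompactAbelianNashGroup (N g : ℕ) where
  /-- The underlying set `A(ℝ) ⊆ ℝ^N`. -/
  pts : Set (Fin N → ℝ)
  /-- `A(ℝ)` is compact (real points of a projective variety). -/
  isCompact_pts : IsCompact pts
  /-- `A(ℝ)` is a `ℚ`-semialgebraic subset of `ℝ^N`. -/
  isSemialgebraic_pts : IsSemialgebraic ℚ pts
  /-- `A(ℝ)` is a `g`-dimensional `C^∞` submanifold of `ℝ^N`. -/
  isSubmanifold_pts : IsSubmanifoldOfDim g pts
  /-- The group law `(x, y) ↦ x + y` (an ambient extension of it). -/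
  add : (Fin N → ℝ) → (Fin N → ℝ) → (Fin N → ℝ)
  /-- The neutral element. -/
  zero : Fin N → ℝ
  /-- The inversion `x ↦ −x` (an ambient extension of it). -/
  neg : (Fin N → ℝ) → (Fin N → ℝ)
  /-- The group law is `C^∞` at every point of `pts × pts`, as a map `ℝ^N × ℝ^N → ℝ^N`. -/
  contDiffAt_add : ∀ x ∈ pts, ∀ y ∈ pts,
    ContDiffAt ℝ ∞ (fun p : (Fin N → ℝ) × (Fin N → ℝ) => add p.1 p.2) (x, y)
  /-- Inversion is `C^∞` at every point of `pts`. -/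
  contDiffAt_neg : ∀ x ∈ pts, ContDiffAt ℝ ∞ neg x
  /-- The group law is a `ℚ`-semialgebraic map on `pts × pts ⊆ ℝ^(N+N)`. -/
  isSemialgebraicMapOn_add : IsSemialgebraicMapOn ℚ (appendProd pts pts)
    (fun z => add (fun i => z (Fin.castAdd N i)) (fun j => z (Fin.natAdd N j)))
  /-- Inversion is a `ℚ`-semialgebraic map on `pts`. -/
  isSemialgebraicMapOn_neg : IsSemialgebraicMapOn ℚ pts neg
  /-- `0 ∈ A(ℝ)`. -/
  zero_mem : zero ∈ pts
  /-- `A(ℝ)` is closed under `+`. -/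
  add_mem : ∀ ⦃x⦄, x ∈ pts → ∀ ⦃y⦄, y ∈ pts → add x y ∈ pts
  /-- `A(ℝ)` is closed under `−`. -/
  neg_mem : ∀ ⦃x⦄, x ∈ pts → neg x ∈ pts
  /-- Associativity on `A(ℝ)`. -/
  add_assoc : ∀ x ∈ pts, ∀ y ∈ pts, ∀ z ∈ pts, add (add x y) z = add x (add y z)
  /-- Commutativity on `A(ℝ)`. -/
  add_comm : ∀ x ∈ pts, ∀ y ∈ pts, add x y = add y x
  /-- `0 + x = x` on `A(ℝ)`. -/
  zero_add : ∀ x ∈ pts, add zero x = x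
  /-- `(−x) + x = 0` on `A(ℝ)`. -/
  neg_add_cancel : ∀ x ∈ pts, add (neg x) x = zero
  /-- The invariant coframe: `g` smooth `1`-forms `ω₁, …, ω_g` on `ℝ^N`. -/
  invForm : Fin g → (Fin N → ℝ) → (Fin N → ℝ) →L[ℝ] ℝ
  /-- Each `ωᵢ` is `C^∞` at every point of `A(ℝ)`. -/
  contDiffAt_invForm : ∀ i, ∀ x ∈ pts, ContDiffAt ℝ ∞ (invForm i) x
  /-- The coefficient functions `x ↦ ωᵢ(x)(eⱼ)` are `ℚ`-semialgebraic on `A(ℝ)`. -/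
  isSemialgebraicFunOn_invForm :
    ∀ i (j : Fin N), IsSemialgebraicFunOn ℚ pts (fun x => invForm i x (Pi.single j 1))
  /-- **Additivity** `ρ^*ωᵢ = pr₁^*ωᵢ + pr₂^*ωᵢ` on tangent vectors of `A(ℝ) × A(ℝ)`: for curves
  `γ₁, γ₂` in `A(ℝ)` with velocities `v₁, v₂` at `0` and `w` the velocity of `γ₁ + γ₂`,
  `ωᵢ(γ₁(0) + γ₂(0))(w) = ωᵢ(γ₁ 0)(v₁) + ωᵢ(γ₂ 0)(v₂)` (Serre III.11, Prop. 17, proof). -/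
  invForm_add : ∀ i ⦃γ₁ γ₂ : ℝ → Fin N → ℝ⦄ ⦃v₁ v₂ w : Fin N → ℝ⦄,
    (∀ᶠ s in 𝓝 (0 : ℝ), γ₁ s ∈ pts) → (∀ᶠ s in 𝓝 (0 : ℝ), γ₂ s ∈ pts) →
    HasDerivAt γ₁ v₁ 0 → HasDerivAt γ₂ v₂ 0 → HasDerivAt (fun s => add (γ₁ s) (γ₂ s)) w 0 →
      invForm i (add (γ₁ 0) (γ₂ 0)) w = invForm i (γ₁ 0) v₁ + invForm i (γ₂ 0) v₂
  /-- **Coframe**: at every `x ∈ A(ℝ)` the `ωᵢ(x)` separate tangent vectors of `A(ℝ)` and are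
  linearly independent as functionals on them (Serre III.11, Cor. 1 to Prop. 16). -/
  invForm_frame : ∀ x ∈ pts,
    (∀ v ∈ tangentVelocities pts x, (∀ i, invForm i x v = 0) → v = 0) ∧
      ∀ c : Fin g → ℝ, (∀ v ∈ tangentVelocities pts x, ∑ i, c i * invForm i x v = 0) → c = 0

namespace CompactAbelianNashGroup

variable {N g : ℕ} (A : CompactAbelianNashGroup N g)

/-- `x + 0 = x` on `A(ℝ)`. [folklore] -/
theorem add_zero {x : Fin N → ℝ} (hx : x ∈ A.pts) : A.add x A.zero = x := by
  rw [A.add_comm x hx A.zero A.zero_mem, A.zero_add x hx]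

/-- `x + (−x) = 0` on `A(ℝ)`. [folklore] -/
theorem add_neg_cancel {x : Fin N → ℝ} (hx : x ∈ A.pts) : A.add x (A.neg x) = A.zero := by
  rw [A.add_comm x hx _ (A.neg_mem hx), A.neg_add_cancel x hx]

/-- Cancellation: `x + y = x + z → y = z` on `A(ℝ)`. [folklore] -/
theorem add_left_cancel {x y z : Fin N → ℝ} (hx : x ∈ A.pts) (hy : y ∈ A.pts) (hz : z ∈ A.pts)
    (h : A.add x y = A.add x z) : y = z := by
  have h' := congrArg (A.add (A.neg x)) h
  rwa [← A.add_assoc _ (A.neg_mem hx) x hx y hy, ← A.add_assoc _ (A.neg_mem hx) x hx z hz,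
    A.neg_add_cancel x hx, A.zero_add y hy, A.zero_add z hz] at h'

/-- The group law is continuous at the points of `A(ℝ) × A(ℝ)` (it is `C^∞` there). [folklore] -/
theorem continuousAt_add {x y : Fin N → ℝ} (hx : x ∈ A.pts) (hy : y ∈ A.pts) :
    ContinuousAt (fun p : (Fin N → ℝ) × (Fin N → ℝ) => A.add p.1 p.2) (x, y) :=
  (A.contDiffAt_add x hx y hy).continuousAt

/-- The group law is continuous on `A(ℝ) × A(ℝ)`. [folklore] -/
theorem continuousOn_add :
    ContinuousOn (fun p : (Fin N → ℝ) × (Fin N → ℝ) => A.add p.1 p.2) (A.pts ×ˢ A.pts) :=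
  fun _ hp => (A.continuousAt_add hp.1 hp.2).continuousWithinAt

/-- Inversion is continuous on `A(ℝ)` (it is `C^∞` there). [folklore] -/
theorem continuousOn_neg : ContinuousOn A.neg A.pts :=
  fun x hx => (A.contDiffAt_neg x hx).continuousAt.continuousWithinAt

/-- The group law is differentiable at the points of `A(ℝ) × A(ℝ)`. [folklore] -/
theorem differentiableAt_add {x y : Fin N → ℝ} (hx : x ∈ A.pts) (hy : y ∈ A.pts) :
    DifferentiableAt ℝ (fun p : (Fin N → ℝ) × (Fin N → ℝ) => A.add p.1 p.2) (x, y) :=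
  (A.contDiffAt_add x hx y hy).differentiableAt (by simp)

/-- Translation by `a ∈ A(ℝ)` maps `A(ℝ)` to itself. [folklore] -/
theorem mapsTo_add_left {a : Fin N → ℝ} (ha : a ∈ A.pts) : MapsTo (A.add a) A.pts A.pts :=
  fun _ hx => A.add_mem ha hx

/-- `a + a = a` forces `a = 0` on `A(ℝ)`. [folklore] -/
theorem eq_zero_of_add_self {a : Fin N → ℝ} (ha : a ∈ A.pts) (h : A.add a a = a) : a = A.zero :=
  A.add_left_cancel ha ha A.zero_mem (h.trans (A.add_zero ha).symm)

/-- **`{0}` is `ℚ`-semialgebraic**: `0` is the unique `z ∈ A(ℝ)` with `z + z = z`, a first-order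
condition in the `ℚ`-semialgebraic data `(pts, add)` — concretely `{0}` is a coordinate projection
of the graph of `add` cut by linear equations (Tarski–Seidenberg, via `IsSemialgebraic.image_comp`).
In the intended instance `0` has real-algebraic coordinates anyway. [cite: BochnakCosteRoy1998, Prop. 2.2.4 and Thm. 2.2.1] -/
theorem isSemialgebraic_singleton_zero : IsSemialgebraic ℚ ({A.zero} : Set (Fin N → ℝ)) := by
  -- the graph of `add` on `pts × pts`, a subset of `ℝ^((N+N)+N)`
  have hG : IsSemialgebraic ℚ {u : Fin (N + N + N) → ℝ | ∃ x ∈ appendProd A.pts A.pts,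
      u = Fin.append x (A.add (fun i => x (Fin.castAdd N i)) (fun j => x (Fin.natAdd N j)))} :=
    A.isSemialgebraicMapOn_add
  -- the linear conditions `x₁ = x₁ + x₂` and `x₂ = x₁ + x₂`
  have hD : IsSemialgebraic ℚ {u : Fin (N + N + N) → ℝ | ∀ i : Fin N,
      u (Fin.castAdd N (Fin.castAdd N i)) = u (Fin.natAdd (N + N) i) ∧
        u (Fin.castAdd N (Fin.natAdd N i)) = u (Fin.natAdd (N + N) i)} := by
    have h1 : ∀ i : Fin N, IsSemialgebraic ℚ {u : Fin (N + N + N) → ℝ |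
        u (Fin.castAdd N (Fin.castAdd N i)) = u (Fin.natAdd (N + N) i) ∧
          u (Fin.castAdd N (Fin.natAdd N i)) = u (Fin.natAdd (N + N) i)} := by
      intro i
      have ha := isSemialgebraic_setOf_eval_eq_zero (k := ℚ) (R := ℝ)
        (MvPolynomial.X (Fin.castAdd N (Fin.castAdd N i)) - MvPolynomial.X (Fin.natAdd (N + N) i) :
          MvPolynomial (Fin (N + N + N)) ℚ)
      have hb := isSemialgebraic_setOf_eval_eq_zero (k := ℚ) (R := ℝ)
        (MvPolynomial.X (Fin.castAdd N (Fin.natAdd N i)) - MvPolynomial.X (Fin.natAdd (N + N) i) :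
          MvPolynomial (Fin (N + N + N)) ℚ)
      convert ha.inter hb using 1
      ext u
      simp [sub_eq_zero]
    convert IsSemialgebraic.biInter Finset.univ _ (fun i _ => h1 i) using 1
    ext u
    simp
  have hI := (hG.inter hD).image_comp (Fin.natAdd (N + N))
  convert hI using 1
  ext z
  simp only [mem_singleton_iff, mem_image, mem_inter_iff, mem_setOf_eq]
  constructor
  · rintro rfl
    refine ⟨Fin.append (Fin.append A.zero A.zero) A.zero,
      ⟨⟨Fin.append A.zero A.zero, ?_, ?_⟩, ?_⟩, ?_⟩
    · exact append_mem_appendProd.mpr ⟨A.zero_mem, A.zero_mem⟩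
    · simp only [Fin.append_left, Fin.append_right]
      rw [A.zero_add _ A.zero_mem]
    · intro i
      simp only [Fin.append_left, Fin.append_right, and_self]
    · funext i
      simp
  · rintro ⟨u, ⟨⟨x, hx, rfl⟩, hd⟩, rfl⟩
    have ha : (fun i => x (Fin.castAdd N i)) ∈ A.pts := (mem_appendProd.mp hx).1
    have h1 : ∀ i, x (Fin.castAdd N i) =
        A.add (fun i => x (Fin.castAdd N i)) (fun j => x (Fin.natAdd N j)) i :=
      fun i => by simpa only [Fin.append_left, Fin.append_right] using (hd i).1
    have h2 : ∀ i, x (Fin.natAdd N i) =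
        A.add (fun i => x (Fin.castAdd N i)) (fun j => x (Fin.natAdd N j)) i :=
      fun i => by simpa only [Fin.append_left, Fin.append_right] using (hd i).2
    have hab : (fun i => x (Fin.castAdd N i)) = fun j => x (Fin.natAdd N j) :=
      funext fun i => (h1 i).trans (h2 i).symm
    have e1 : A.add (fun i => x (Fin.castAdd N i)) (fun j => x (Fin.natAdd N j)) =
        fun i => x (Fin.castAdd N i) := (funext h1).symm
    have e2 : A.add (fun i => x (Fin.castAdd N i)) (fun i => x (Fin.castAdd N i)) =
        fun i => x (Fin.castAdd N i) := by
      rw [← hab] at e1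
      exact e1
    have ha0 := A.eq_zero_of_add_self ha e2
    have hc : (Fin.append x (A.add (fun i => x (Fin.castAdd N i)) (fun j => x (Fin.natAdd N j)))) ∘
        Fin.natAdd (N + N) = A.add (fun i => x (Fin.castAdd N i)) (fun j => x (Fin.natAdd N j)) :=
      funext fun i => Fin.append_right _ _ i
    rw [hc, e1, ha0]

/-- Constant maps with value `0` are `ℚ`-semialgebraic on every `ℚ`-semialgebraic set (their
graph is `s × {0}`). [cite: BochnakCosteRoy1998, §2.2 (after Def. 2.2.5)] -/
theorem isSemialgebraicMapOn_const_zero {m : ℕ} {s : Set (Fin m → ℝ)} (hs : IsSemialgebraic ℚ s) :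
    IsSemialgebraicMapOn ℚ s (fun _ => A.zero) := by
  have h := isSemialgebraic_appendProd hs A.isSemialgebraic_singleton_zero
  unfold IsSemialgebraicMapOn
  convert h using 1
  ext z
  simp only [mem_setOf_eq, mem_appendProd, mem_singleton_iff]
  constructor
  · rintro ⟨x, hx, rfl⟩
    refine ⟨?_, ?_⟩
    · convert hx using 1
      funext i
      exact Fin.append_left x A.zero i
    · funext j
      exact Fin.append_right x A.zero j
  · rintro ⟨h1, h2⟩
    refine ⟨fun i => z (Fin.castAdd N i), h1, ?_⟩
    rw [← h2]
    exact (Fin.append_castAdd_natAdd (f := z)).symm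

/-- **The identity component `A(ℝ)°`**: the connected component of `0` in `A(ℝ)` (Gross–Harris
1981, §1: "`A(ℝ)°` … the connected component of the identity in the group `A(ℝ)` of real points";
by Prop. 1.1 (1) it is a real torus of dimension `g`). [cite: GrossHarris1981, §1 (before Prop. 1.1)] -/
def idComponent : Set (Fin N → ℝ) :=
  connectedComponentIn A.pts A.zero

/-- `0 ∈ A(ℝ)°`. [folklore] -/
theorem zero_mem_idComponent : A.zero ∈ A.idComponent :=
  mem_connectedComponentIn A.zero_mem

/-- `A(ℝ)° ⊆ A(ℝ)`. [folklore] -/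
theorem idComponent_subset : A.idComponent ⊆ A.pts :=
  connectedComponentIn_subset _ _

/-- `A(ℝ)°` is connected. [folklore] -/
theorem isConnected_idComponent : IsConnected A.idComponent :=
  isConnected_connectedComponentIn_iff.mpr A.zero_mem

/-- **Translation invariance of the coframe** (from additivity with a constant first curve): for
`a ∈ A(ℝ)` and a curve `γ` in `A(ℝ)` with velocity `v` at `0`, if `w` is the velocity of
`s ↦ a + γ(s)` then `ωᵢ(a + γ 0)(w) = ωᵢ(γ 0)(v)` (Serre III.11: invariant forms). [cite: Serre1988, Ch. III no. 11, Prop. 16 Cor. 1 and Prop. 17] -/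
theorem invForm_translate (i : Fin g) {a : Fin N → ℝ} (ha : a ∈ A.pts) {γ : ℝ → Fin N → ℝ}
    {v w : Fin N → ℝ} (hγ : ∀ᶠ s in 𝓝 (0 : ℝ), γ s ∈ A.pts) (hv : HasDerivAt γ v 0)
    (hw : HasDerivAt (fun s => A.add a (γ s)) w 0) :
    A.invForm i (A.add a (γ 0)) w = A.invForm i (γ 0) v := by
  have h := A.invForm_add i (γ₁ := fun _ => a) (Eventually.of_forall fun _ => ha) hγ
    (hasDerivAt_const 0 a) hv hw
  simpa using h

end CompactAbelianNashGroup

/-! ### The real Abel–Jacobi package of a curve -/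

/-- **The real Abel–Jacobi package** of a real curve: the elementary shape of
`(C(ℝ), J(ℝ), +, f^{P₀}, invariant differentials, differentials of the first kind)` for a smooth
projective geometrically irreducible curve `C` of genus `g` over a real-algebraic field `k ⊆ ℝ`
with a `k`-point `P₀` (Gross–Harris 1981, §§1–2; Milne, *Jacobian Varieties*, §2). It extends a
`CompactAbelianNashGroup N g` (the real points `pts = J(ℝ)` of the Jacobian with the group law and
an invariant coframe `invForm`) by: a compact `ℚ`-semialgebraic `1`-dimensional `C^∞` submanifold
`C ⊆ ℝ^M` (the real points of the curve) with a base point `base` (so `C(ℝ) ≠ ∅`); the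
**Abel–Jacobi map** `aj` (`x ↦ [x − P₀]`), a map `ℝ^M → ℝ^N` which is `C^∞` at the points of `C`,
`ℚ`-semialgebraic on `C`, maps `C` into `pts` and `base` to `zero`; and `g` `1`-forms
`curveForm i` on `ℝ^M`, `C^∞` at the points of `C` and with `ℚ`-semialgebraic coefficients on `C`,
satisfying **Abel's theorem
in differential form**: `aj^*(invForm i) = curveForm i` on tangent vectors of `C`
(Serre 1988, Ch. V no. 10, Prop. 5 and Cor. 1: `ω ↦ φ^*ω` is a bijection from the invariant
differentials on `J` onto the differentials of the first kind on `C`; Griffiths–Harris §2.2).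
The summation maps `C^n → J` are `ajSum`, and `J(ℝ)°` is `idComponent`. Existence for actual
curves is the separate named fact `RealAbelJacobi.exists_realization` (end of this file).
[cite: GrossHarris1981, §2 (p. 159)] [cite: Serre1988, Ch. V no. 10, Prop. 5 and Cor. 1] [cite: Milne1986JacobianVarieties, §2 (f^P) and Prop. 2.2] -/
structure RealAbelJacobi (M N g : ℕ) extends CompactAbelianNashGroup N g where
  /-- The real points `C(ℝ) ⊆ ℝ^M` of the curve. -/
  C : Set (Fin M → ℝ)
  /-- `C(ℝ)` is compact. -/
  isCompact_C : IsCompact C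
  /-- `C(ℝ)` is `ℚ`-semialgebraic. -/
  isSemialgebraic_C : IsSemialgebraic ℚ C
  /-- `C(ℝ)` is a `1`-dimensional `C^∞` submanifold of `ℝ^M` (a finite union of ovals). -/
  isSubmanifold_C : IsSubmanifoldOfDim 1 C
  /-- The base point `P₀ ∈ C(ℝ)`. -/
  base : Fin M → ℝ
  /-- `P₀ ∈ C(ℝ)`; in particular `C(ℝ) ≠ ∅`. -/
  base_mem : base ∈ C
  /-- The Abel–Jacobi map `f^{P₀} : x ↦ [x − P₀]` (an ambient extension of it). -/
  aj : (Fin M → ℝ) → (Fin N → ℝ)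
  /-- `aj` is `C^∞` at every point of `C(ℝ)`. -/
  contDiffAt_aj : ∀ x ∈ C, ContDiffAt ℝ ∞ aj x
  /-- `aj` is a `ℚ`-semialgebraic map on `C(ℝ)`. -/
  isSemialgebraicMapOn_aj : IsSemialgebraicMapOn ℚ C aj
  /-- `aj (C(ℝ)) ⊆ J(ℝ)`. -/
  aj_mem : ∀ ⦃x⦄, x ∈ C → aj x ∈ pts
  /-- `aj P₀ = 0`. -/
  aj_base : aj base = zero
  /-- The differentials of the first kind `α₁, …, α_g` realised as smooth `1`-forms on `ℝ^M`. -/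
  curveForm : Fin g → (Fin M → ℝ) → (Fin M → ℝ) →L[ℝ] ℝ
  /-- Each `αᵢ` is `C^∞` at every point of `C(ℝ)`. -/
  contDiffAt_curveForm : ∀ i, ∀ x ∈ C, ContDiffAt ℝ ∞ (curveForm i) x
  /-- The coefficient functions `x ↦ αᵢ(x)(eⱼ)` are `ℚ`-semialgebraic on `C(ℝ)`. -/
  isSemialgebraicFunOn_curveForm :
    ∀ i (j : Fin M), IsSemialgebraicFunOn ℚ C (fun x => curveForm i x (Pi.single j 1))
  /-- **Abel's theorem in differential form**, `aj^* ωᵢ = αᵢ` on tangent vectors of `C(ℝ)`: for a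
  curve `γ` in `C(ℝ)` with velocity `v` at `0` and `w` the velocity of `aj ∘ γ` at `0`,
  `ωᵢ(aj (γ 0))(w) = αᵢ(γ 0)(v)` (Serre V.10, Prop. 5 and Cor. 1). -/
  invForm_aj : ∀ i ⦃γ : ℝ → Fin M → ℝ⦄ ⦃v : Fin M → ℝ⦄ ⦃w : Fin N → ℝ⦄,
    (∀ᶠ s in 𝓝 (0 : ℝ), γ s ∈ C) → HasDerivAt γ v 0 → HasDerivAt (fun s => aj (γ s)) w 0 →
      invForm i (aj (γ 0)) w = curveForm i (γ 0) v

namespace RealAbelJacobi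

variable {M N g : ℕ} (R : RealAbelJacobi M N g)

/-- `C(ℝ) ≠ ∅`. [folklore] -/
theorem C_nonempty : R.C.Nonempty := ⟨R.base, R.base_mem⟩

/-- `aj` maps `C(ℝ)` into `J(ℝ)`. [folklore] -/
theorem mapsTo_aj : MapsTo R.aj R.C R.pts := fun _ hx => R.aj_mem hx

/-- `aj` is continuous at the points of `C(ℝ)` (it is `C^∞` there). [folklore] -/
theorem continuousAt_aj {x : Fin M → ℝ} (hx : x ∈ R.C) : ContinuousAt R.aj x :=
  (R.contDiffAt_aj x hx).continuousAt

/-- `aj` is continuous on `C(ℝ)`. [folklore] -/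
theorem continuousOn_aj : ContinuousOn R.aj R.C :=
  fun _ hx => (R.continuousAt_aj hx).continuousWithinAt

/-- `aj` is differentiable at the points of `C(ℝ)`. [folklore] -/
theorem differentiableAt_aj {x : Fin M → ℝ} (hx : x ∈ R.C) : DifferentiableAt ℝ R.aj x :=
  (R.contDiffAt_aj x hx).differentiableAt (by simp)

/-- `0 = aj P₀` lies in `aj (C(ℝ))`; hence `aj (C(ℝ))` meets `J(ℝ)°`. [folklore] -/
theorem zero_mem_image_aj : R.zero ∈ R.aj '' R.C := ⟨R.base, R.base_mem, R.aj_base⟩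

/-- **The summation maps** `C^n → J`, `(x₁, …, xₙ) ↦ aj x₁ + ⋯ + aj xₙ` (left-nested), i.e.
`[x₁ + ⋯ + xₙ − n P₀]` (Gross–Harris 1981, §2, the map `φ : S^d X → Pic^d` composed with the
translation by `−d P₀`; Milne §5). [cite: GrossHarris1981, §2 (p. 159)] -/
def ajSum : (n : ℕ) → (Fin n → Fin M → ℝ) → (Fin N → ℝ)
  | 0, _ => R.zero
  | n + 1, x => R.add (ajSum n (fun i => x (Fin.castSucc i))) (R.aj (x (Fin.last n)))

/-- `ajSum 0 = 0`. [folklore] -/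
@[simp] theorem ajSum_zero (x : Fin 0 → Fin M → ℝ) : R.ajSum 0 x = R.zero := rfl

/-- `ajSum (n+1) (x₁,…,xₙ₊₁) = ajSum n (x₁,…,xₙ) + aj xₙ₊₁`. [folklore] -/
theorem ajSum_succ (n : ℕ) (x : Fin (n + 1) → Fin M → ℝ) :
    R.ajSum (n + 1) x = R.add (R.ajSum n (fun i => x (Fin.castSucc i))) (R.aj (x (Fin.last n))) :=
  rfl

/-- The summation maps take `C(ℝ)^n` into `J(ℝ)`. [folklore] -/
theorem ajSum_mem : ∀ (n : ℕ) {x : Fin n → Fin M → ℝ}, (∀ i, x i ∈ R.C) → R.ajSum n x ∈ R.pts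
  | 0, _, _ => R.zero_mem
  | n + 1, _, hx => R.add_mem (ajSum_mem n fun i => hx (Fin.castSucc i)) (R.aj_mem (hx _))

/-- `ajSum 1 x = aj x₀` for `x₀ ∈ C(ℝ)`. [folklore] -/
theorem ajSum_one {x : Fin 1 → Fin M → ℝ} (hx : x 0 ∈ R.C) : R.ajSum 1 x = R.aj (x 0) := by
  rw [ajSum_succ, ajSum_zero]
  exact R.zero_add _ (R.aj_mem hx)

/-- The summation maps are continuous at the points of `C(ℝ)^n`. [folklore] -/
theorem continuousAt_ajSum :
    ∀ (n : ℕ) {x : Fin n → Fin M → ℝ}, (∀ i, x i ∈ R.C) → ContinuousAt (R.ajSum n) x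
  | 0, _, _ => continuousAt_const
  | n + 1, x, hx => by
    have h1 : ContinuousAt (fun y : Fin (n + 1) → Fin M → ℝ => R.ajSum n fun i => y (Fin.castSucc i))
        x :=
      ContinuousAt.comp (g := R.ajSum n) (f := fun (y : Fin (n + 1) → Fin M → ℝ) i => y (Fin.castSucc i))
        (continuousAt_ajSum n fun i => hx (Fin.castSucc i))
        (continuous_pi fun i => continuous_apply (Fin.castSucc i)).continuousAt
    have h2 : ContinuousAt (fun y : Fin (n + 1) → Fin M → ℝ => R.aj (y (Fin.last n))) x :=
      ContinuousAt.comp (g := R.aj) (f := fun y : Fin (n + 1) → Fin M → ℝ => y (Fin.last n))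
        (R.continuousAt_aj (hx (Fin.last n))) (continuous_apply (Fin.last n)).continuousAt
    exact ContinuousAt.comp (g := fun p : (Fin N → ℝ) × (Fin N → ℝ) => R.add p.1 p.2)
      (f := fun y : Fin (n + 1) → Fin M → ℝ => (R.ajSum n fun i => y (Fin.castSucc i), R.aj (y (Fin.last n))))
      (R.continuousAt_add (R.ajSum_mem n fun i => hx (Fin.castSucc i)) (R.aj_mem (hx (Fin.last n))))
      (h1.prodMk h2)

/-- **Abel's addition formula for two moving points.** For curves `γ₁, γ₂` in `C(ℝ)` with
velocities `v₁, v₂` at `0`, and `w` the velocity at `0` of `s ↦ aj (γ₁ s) + aj (γ₂ s)` in `J(ℝ)`,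
`ωᵢ(aj γ₁(0) + aj γ₂(0))(w) = αᵢ(γ₁ 0)(v₁) + αᵢ(γ₂ 0)(v₂)`: additivity of invariant forms
(Serre III.11, Prop. 17) combined with `aj^*ωᵢ = αᵢ` (Serre V.10, Cor. 1) — the pointwise
integrand identity behind Abel's theorem `∫^{x₁} α + ∫^{x₂} α ≡ const` when `aj x₁ + aj x₂` is
constant. [cite: Serre1988, Ch. III no. 11 Prop. 17 and Ch. V no. 10 Cor. 1] -/
theorem invForm_aj_add (i : Fin g) {γ₁ γ₂ : ℝ → Fin M → ℝ} {v₁ v₂ : Fin M → ℝ} {w : Fin N → ℝ}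
    (h₁ : ∀ᶠ s in 𝓝 (0 : ℝ), γ₁ s ∈ R.C) (h₂ : ∀ᶠ s in 𝓝 (0 : ℝ), γ₂ s ∈ R.C)
    (hv₁ : HasDerivAt γ₁ v₁ 0) (hv₂ : HasDerivAt γ₂ v₂ 0)
    (hw : HasDerivAt (fun s => R.add (R.aj (γ₁ s)) (R.aj (γ₂ s))) w 0) :
    R.invForm i (R.add (R.aj (γ₁ 0)) (R.aj (γ₂ 0))) w =
      R.curveForm i (γ₁ 0) v₁ + R.curveForm i (γ₂ 0) v₂ := by
  -- velocities of `aj ∘ γₖ` exist since `aj` is `C^∞` at `γₖ 0 ∈ C(ℝ)`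
  have hw₁ : HasDerivAt (fun s => R.aj (γ₁ s)) (fderiv ℝ R.aj (γ₁ 0) v₁) 0 :=
    (R.differentiableAt_aj h₁.self_of_nhds).hasFDerivAt.comp_hasDerivAt 0 hv₁
  have hw₂ : HasDerivAt (fun s => R.aj (γ₂ s)) (fderiv ℝ R.aj (γ₂ 0) v₂) 0 :=
    (R.differentiableAt_aj h₂.self_of_nhds).hasFDerivAt.comp_hasDerivAt 0 hv₂
  rw [R.invForm_add i (h₁.mono fun s hs => R.aj_mem hs) (h₂.mono fun s hs => R.aj_mem hs) hw₁ hw₂ hw,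
    R.invForm_aj i h₁ hv₁ hw₁, R.invForm_aj i h₂ hv₂ hw₂]

/-- **`C(ℝ)ⁿ ⊆ ℝ^(M·n)` in appended coordinates** (the domain of the summation map as a map between
Euclidean spaces): `powC 0 = ℝ⁰`, `powC (n+1) = powC n × C(ℝ)` via `appendProd`
(note `M·(n+1) = M·n + M` definitionally). [folklore] -/
def powC : (n : ℕ) → Set (Fin (M * n) → ℝ)
  | 0 => univ
  | n + 1 => appendProd (powC n) R.C

/-- **The summation map `C(ℝ)ⁿ → J(ℝ)` in appended coordinates**, `(x₁, …, xₙ) ↦ aj x₁ + ⋯ + aj xₙ`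
(left-nested; the same values as `ajSum`, but as a map `ℝ^(M·n) → ℝ^N`, the shape required by
`IsSemialgebraicMapOn`): `sumMap (n+1) (x, y) = sumMap n x + aj y`. Gross–Harris 1981, §2: the map
`S^d X → Pic^d` is defined over `ℝ` (here composed with translation by `−d·P₀`). [cite: GrossHarris1981, §2 (p. 159)] -/
def sumMap : (n : ℕ) → (Fin (M * n) → ℝ) → (Fin N → ℝ)
  | 0 => fun _ => R.zero
  | n + 1 => fun z =>
      R.add (sumMap n (fun i => z (Fin.castAdd M i))) (R.aj (fun j => z (Fin.natAdd (M * n) j)))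

/-- `powC 0 = univ` (a point). [folklore] -/
@[simp] theorem powC_zero : R.powC 0 = univ := rfl

/-- `powC (n+1) = powC n × C(ℝ)`. [folklore] -/
theorem powC_succ (n : ℕ) : R.powC (n + 1) = appendProd (R.powC n) R.C := rfl

/-- `sumMap 0 = 0`. [folklore] -/
@[simp] theorem sumMap_zero (z : Fin (M * 0) → ℝ) : R.sumMap 0 z = R.zero := rfl

/-- `sumMap (n+1) (x, y) = sumMap n x + aj y`. [folklore] -/
theorem sumMap_succ (n : ℕ) (z : Fin (M * (n + 1)) → ℝ) :
    R.sumMap (n + 1) z =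
      R.add (R.sumMap n (fun i => z (Fin.castAdd M i))) (R.aj (fun j => z (Fin.natAdd (M * n) j))) :=
  rfl

/-- `sumMap (n+1) (Fin.append x y) = sumMap n x + aj y`. [folklore] -/
theorem sumMap_succ_append (n : ℕ) (x : Fin (M * n) → ℝ) (y : Fin M → ℝ) :
    R.sumMap (n + 1) (Fin.append x y) = R.add (R.sumMap n x) (R.aj y) := by
  show R.add (R.sumMap n (fun i => Fin.append x y (Fin.castAdd M i)))
      (R.aj (fun j => Fin.append x y (Fin.natAdd (M * n) j))) = _
  simp only [Fin.append_left, Fin.append_right]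

/-- The summation map takes `C(ℝ)ⁿ` into `J(ℝ)`. [folklore] -/
theorem sumMap_mem : ∀ (n : ℕ) {z : Fin (M * n) → ℝ}, z ∈ R.powC n → R.sumMap n z ∈ R.pts
  | 0, _, _ => R.zero_mem
  | n + 1, _, hz => R.add_mem (sumMap_mem n hz.1) (R.aj_mem hz.2)

/-- `C(ℝ)ⁿ` (appended coordinates) is `ℚ`-semialgebraic. [cite: BochnakCosteRoy1998, §2.1 (products, after Def. 2.1.4)] -/
theorem isSemialgebraic_powC : ∀ n : ℕ, IsSemialgebraic ℚ (R.powC n)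
  | 0 => isSemialgebraic_univ
  | n + 1 => (IsSemialgebraic.preimage_comp (Fin.castAdd M) (isSemialgebraic_powC n)).inter
      (R.isSemialgebraic_C.preimage_comp (Fin.natAdd (M * n)))

/-- **Appended coordinates of a tuple of points**: `flatten n (x₁, …, xₙ) ∈ ℝ^(M·n)` is
`(flatten (n-1) (x₁, …, xₙ₋₁), xₙ)` via `Fin.append` (and the empty vector for `n = 0`); it
identifies the tuple shape used by `ajSum` with the Euclidean shape used by `sumMap`. [folklore] -/
def flatten : (n : ℕ) → (Fin n → Fin M → ℝ) → (Fin (M * n) → ℝ)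
  | 0, _ => Fin.elim0
  | n + 1, x => Fin.append (flatten n (fun l => x (Fin.castSucc l))) (x (Fin.last n))

/-- `flatten (n+1) x = (flatten n (init x), x (last n))`. [folklore] -/
theorem flatten_succ (n : ℕ) (x : Fin (n + 1) → Fin M → ℝ) :
    flatten (M := M) (n + 1) x =
      Fin.append (flatten n (fun l => x (Fin.castSucc l))) (x (Fin.last n)) :=
  rfl

/-- A tuple of points of `C(ℝ)` flattens into `powC n = C(ℝ)ⁿ`. [folklore] -/
theorem flatten_mem_powC : ∀ (n : ℕ) {x : Fin n → Fin M → ℝ}, (∀ l, x l ∈ R.C) → flatten n x ∈ R.powC n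
  | 0, _, _ => mem_univ _
  | n + 1, _, hx => by
    rw [flatten_succ, powC_succ, append_mem_appendProd]
    exact ⟨flatten_mem_powC n fun l => hx _, hx _⟩

/-- Conversely, membership of the flattened tuple in `powC n` means every point lies in `C(ℝ)`. [folklore] -/
theorem flatten_mem_powC_iff : ∀ (n : ℕ) (x : Fin n → Fin M → ℝ),
    flatten n x ∈ R.powC n ↔ ∀ l, x l ∈ R.C
  | 0, x => by simp [flatten]
  | n + 1, x => by
    rw [flatten_succ, powC_succ, append_mem_appendProd, flatten_mem_powC_iff n]
    constructor
    · rintro ⟨h, hl⟩ l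
      refine Fin.lastCases ?_ (fun i => ?_) l
      · exact hl
      · exact h i
    · intro h
      exact ⟨fun l => h _, h _⟩

/-- **The two shapes of the summation map agree**: `sumMap n (flatten n x) = ajSum n x`. [folklore] -/
theorem sumMap_flatten : ∀ (n : ℕ) (x : Fin n → Fin M → ℝ), R.sumMap n (flatten n x) = R.ajSum n x
  | 0, _ => rfl
  | n + 1, x => by
    rw [flatten_succ, sumMap_succ_append, sumMap_flatten n, ajSum_succ]

/-- **The summation maps `C(ℝ)ⁿ → J(ℝ)` are `ℚ`-semialgebraic** (as maps `ℝ^(M·n) ⊇ powC n → ℝ^N`):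
induction on `n`, the step being the composite of the `ℚ`-semialgebraic group law with the pairing
of `sumMap n ∘ pr₁` and `aj ∘ pr₂` (closure of semialgebraic maps under composition,
`IsSemialgebraicMapOn.comp_holds`, i.e. BCR Prop. 2.2.6 via Tarski–Seidenberg); the base case is the
constant map `0` (`isSemialgebraicMapOn_const_zero`). Gross–Harris 1981, §2: `S^d X → Pic^d` is
defined over `ℝ`; here with `ℚ`-structure. [cite: GrossHarris1981, §2 (p. 159)] [cite: BochnakCosteRoy1998, Prop. 2.2.6] -/
theorem isSemialgebraicMapOn_sumMap : ∀ n : ℕ, IsSemialgebraicMapOn ℚ (R.powC n) (R.sumMap n)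
  | 0 => R.isSemialgebraicMapOn_const_zero isSemialgebraic_univ
  | n + 1 => by
    have hs : IsSemialgebraic ℚ (R.powC (n + 1)) := R.isSemialgebraic_powC (n + 1)
    -- the two block projections, restricted to `powC (n+1) = powC n × C`
    have hp₁ : IsSemialgebraicMapOn ℚ (R.powC (n + 1))
        (fun z (i : Fin (M * n)) => z (Fin.castAdd M i)) := isSemialgebraicMapOn_castAdd hs
    have hp₂ : IsSemialgebraicMapOn ℚ (R.powC (n + 1))
        (fun z (j : Fin M) => z (Fin.natAdd (M * n) j)) := isSemialgebraicMapOn_natAdd hs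
    have hm₁ : MapsTo (fun (z : Fin (M * n + M) → ℝ) (i : Fin (M * n)) => z (Fin.castAdd M i))
        (R.powC (n + 1)) (R.powC n) := fun z hz => hz.1
    have hm₂ : MapsTo (fun (z : Fin (M * n + M) → ℝ) (j : Fin M) => z (Fin.natAdd (M * n) j))
        (R.powC (n + 1)) R.C := fun z hz => hz.2
    -- `sumMap n ∘ pr₁` and `aj ∘ pr₂`
    have h₁ : IsSemialgebraicMapOn ℚ (R.powC (n + 1))
        (R.sumMap n ∘ fun z (i : Fin (M * n)) => z (Fin.castAdd M i)) :=
      IsSemialgebraicMapOn.comp_holds (isSemialgebraicMapOn_sumMap n) hp₁ hm₁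
    have h₂ : IsSemialgebraicMapOn ℚ (R.powC (n + 1))
        (R.aj ∘ fun z (j : Fin M) => z (Fin.natAdd (M * n) j)) :=
      IsSemialgebraicMapOn.comp_holds R.isSemialgebraicMapOn_aj hp₂ hm₂
    -- their pairing lands in `pts × pts`, where `add` is semialgebraic
    have hP := h₁.append h₂
    have hmP : MapsTo (fun z => Fin.append ((R.sumMap n ∘ fun z (i : Fin (M * n)) => z (Fin.castAdd M i)) z)
        ((R.aj ∘ fun z (j : Fin M) => z (Fin.natAdd (M * n) j)) z)) (R.powC (n + 1))
        (appendProd R.pts R.pts) :=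
      fun z hz => append_mem_appendProd.mpr ⟨R.sumMap_mem n (hm₁ hz), R.aj_mem (hm₂ hz)⟩
    have h := IsSemialgebraicMapOn.comp_holds R.isSemialgebraicMapOn_add hP hmP
    refine h.congr fun z _ => ?_
    simp only [Function.comp_apply, Fin.append_left, Fin.append_right]
    rfl

/-- Along curves `γ₁, …, γₙ` in `C(ℝ)` differentiable at `0`, the moving sum
`s ↦ aj (γ₁ s) + ⋯ + aj (γₙ s)` is differentiable at `0` (chain rule through the `C^∞` points of
`add` and `aj`). [folklore] -/
theorem differentiableAt_ajSum_comp :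
    ∀ (n : ℕ) {γ : Fin n → ℝ → Fin M → ℝ}, (∀ l, ∀ᶠ s in 𝓝 (0 : ℝ), γ l s ∈ R.C) →
      (∀ l, DifferentiableAt ℝ (γ l) 0) →
        DifferentiableAt ℝ (fun s => R.ajSum n (fun l => γ l s)) 0
  | 0, _, _, _ => differentiableAt_const _
  | n + 1, γ, hγ, hd => by
    have h0 : ∀ l, γ l 0 ∈ R.C := fun l => (hγ l).self_of_nhds
    have h1 : DifferentiableAt ℝ (fun s => R.ajSum n (fun l => γ (Fin.castSucc l) s)) 0 :=
      differentiableAt_ajSum_comp n (fun l => hγ _) (fun l => hd _)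
    have h2 : DifferentiableAt ℝ (fun s => R.aj (γ (Fin.last n) s)) 0 :=
      (R.differentiableAt_aj (h0 _)).comp (0 : ℝ) (hd _)
    exact (R.differentiableAt_add (R.ajSum_mem n fun l => h0 (Fin.castSucc l)) (R.aj_mem (h0 _))).comp
      (0 : ℝ) (h1.prodMk h2)

/-- **Abel's theorem pointwise, for `n` moving points.** For curves `γ₁, …, γₙ` in `C(ℝ)` with
velocities `v₁, …, vₙ` at `0`, and `w` the velocity at `0` of the moving sum
`s ↦ aj (γ₁ s) + ⋯ + aj (γₙ s)` in `J(ℝ)`, every invariant form satisfies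
`ωᵢ(Σₗ aj γₗ(0))(w) = Σₗ αᵢ(γₗ 0)(vₗ)` — additivity `(f₁ + ⋯ + fₙ)^*ω = Σ fₗ^*ω` (Serre III.11,
Prop. 17) with `aj^*ωᵢ = αᵢ` (Serre V.10, Cor. 1). When the moving sum is constant (the points
`γₗ(s)` form the divisor of a moving function, Abel), `w = 0` and the right-hand side vanishes:
the integrand identity `Σₗ αᵢ(γₗ(s))(γₗ′(s)) = 0`. [cite: Serre1988, Ch. III no. 11 Prop. 17 and Ch. V no. 10 Cor. 1] -/
theorem invForm_ajSum (i : Fin g) :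
    ∀ (n : ℕ) {γ : Fin n → ℝ → Fin M → ℝ} {v : Fin n → Fin M → ℝ} {w : Fin N → ℝ},
      (∀ l, ∀ᶠ s in 𝓝 (0 : ℝ), γ l s ∈ R.C) → (∀ l, HasDerivAt (γ l) (v l) 0) →
        HasDerivAt (fun s => R.ajSum n (fun l => γ l s)) w 0 →
          R.invForm i (R.ajSum n (fun l => γ l 0)) w = ∑ l, R.curveForm i (γ l 0) (v l)
  | 0, _, _, w, _, _, hw => by
    have hw0 : w = 0 := hw.unique (hasDerivAt_const (0 : ℝ) R.zero)
    simp [hw0]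
  | n + 1, γ, v, w, hγ, hv, hw => by
    have h0 : ∀ l, γ l 0 ∈ R.C := fun l => (hγ l).self_of_nhds
    -- velocities of the two summands `Γ₁ s = Σ_{l<n} aj (γₗ s)` and `Γ₂ s = aj (γₙ s)`
    have hd1 : DifferentiableAt ℝ (fun s => R.ajSum n (fun l => γ (Fin.castSucc l) s)) 0 :=
      R.differentiableAt_ajSum_comp n (fun l => hγ _) (fun l => (hv _).differentiableAt)
    have hw₁ := hd1.hasDerivAt
    have hw₂ : HasDerivAt (fun s => R.aj (γ (Fin.last n) s))
        (fderiv ℝ R.aj (γ (Fin.last n) 0) (v (Fin.last n))) 0 :=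
      (R.differentiableAt_aj (h0 _)).hasFDerivAt.comp_hasDerivAt 0 (hv _)
    -- both summand curves stay in `J(ℝ)` near `0`
    have hmem₁ : ∀ᶠ s in 𝓝 (0 : ℝ), R.ajSum n (fun l => γ (Fin.castSucc l) s) ∈ R.pts := by
      have hall : ∀ᶠ s in 𝓝 (0 : ℝ), ∀ l, γ (Fin.castSucc l) s ∈ R.C := eventually_all.mpr fun l => hγ _
      exact hall.mono fun s hs => R.ajSum_mem n hs
    have hmem₂ : ∀ᶠ s in 𝓝 (0 : ℝ), R.aj (γ (Fin.last n) s) ∈ R.pts :=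
      (hγ _).mono fun s hs => R.aj_mem hs
    have key := R.invForm_add i hmem₁ hmem₂ hw₁ hw₂ hw
    rw [ajSum_succ, key, invForm_ajSum i n (fun l => hγ _) (fun l => hv _) hw₁,
      R.invForm_aj i (hγ _) (hv _) hw₂, Fin.sum_univ_castSucc]

end RealAbelJacobi

end Literature.AlgebraicGeometry.RealAlgebraic

/-! ### Existence: the real points of an actual curve and of its Jacobian

Only this section uses scheme theory (`Literature.AlgebraicGeometry.Motives.Jacobian`). -/

open CategoryTheory AlgebraicGeometry

namespace Literature.AlgebraicGeometry.RealAlgebraic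

open Literature.ModelTheory.ExponentialFields Literature.NumberTheory.Transcendental
open Literature.AlgebraicGeometry.Motives

namespace RealAbelJacobi

/-- A **realization** of a real Abel–Jacobi package `R : RealAbelJacobi M N g` by an actual curve:
`C` a `k`-scheme for a subfield `k ⊆ ℝ` (`[Algebra k ℝ]`), `P₀ ∈ C(k)` a rational base point and
`𝒥` a Jacobian of `C` (`Literature.AlgebraicGeometry.Motives.Jacobian`, Milne Thm. 1.1/Prop. 6.4).
It consists of topological embeddings (for the strong topology of
`Literature.AlgebraicGeometry.Motives.AlgPoints`) `eC : C(ℝ) → ℝ^M` onto `R.C` and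
`eJ : J(ℝ) → ℝ^N` onto `R.pts` such that: `eJ` carries Mathlib's (multiplicatively written) group
law of `J(ℝ) = 𝒥.J.Points ℝ` to `R.add`; `eJ ∘ f^{P₀} = R.aj ∘ eC` on `C(ℝ)` for the canonical map
`f^{P₀} = 𝒥.abelJacobi P₀` (Milne §2); `eC` sends the real point underlying `P₀` to `R.base`; the
coordinates of `eC`, `eJ` are the values of regular functions defined on a Zariski open containing
all real points (as for the embedding `ℝPⁿ ≅ G(n+1,1) ⊂ ℝ^{(n+1)²}`, `x ↦ (xᵢxⱼ/|x|²)`, of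
Akbulut–King, Ch. II §4, Prop. 2.4.1); and every regular function on a Zariski open `U` is, on
`U(ℝ)`, a `ℚ`-semialgebraic function of the coordinates. [cite: GrossHarris1981, §2 (p. 159)] [cite: AkbulutKing1992, Ch. II §4, Prop. 2.4.1 and Cor. 2.4.2] [cite: Milne1986JacobianVarieties, §2 (definition of f^P)] -/
structure Realization {M N g : ℕ} (R : RealAbelJacobi M N g) {k : Type} [Field k] [Algebra k ℝ]
    (C : SchemeOver k) (P₀ : AlgPoints C k) (𝒥 : Jacobian C) where
  /-- Coordinates of the real points of the curve: `C(ℝ) → ℝ^M`. -/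
  eC : AlgPoints C ℝ → (Fin M → ℝ)
  /-- `eC` is a topological embedding (strong topology on `C(ℝ)`). -/
  isEmbedding_eC : Topology.IsEmbedding eC
  /-- `eC (C(ℝ)) = R.C`. -/
  range_eC : Set.range eC = R.C
  /-- The real point underlying `P₀` goes to the base point of `R`. -/
  eC_base : eC (toSpecOver (specOver k ℝ) ≫ P₀) = R.base
  /-- The coordinates of `eC` are regular functions `f₁, …, f_M` on a Zariski open `U ⊆ C`
  containing every real point, evaluated at the point. -/
  exists_eval_eq_eC : ∃ (U : C.left.Opens) (f : Fin M → Γ(C.left, U))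
    (hU : ∀ P : AlgPoints C ℝ, P.pt ∈ U), ∀ (P : AlgPoints C ℝ) (j : Fin M), eC P j = P.eval U (hU P) (f j)
  /-- Every regular function `f` on a Zariski open `U ⊆ C` is, on `U(ℝ)`, a `ℚ`-semialgebraic
  function of the coordinates. -/
  exists_isSemialgebraicFunOn_eval_C : ∀ (U : C.left.Opens) (f : Γ(C.left, U)),
    ∃ F : (Fin M → ℝ) → ℝ, IsSemialgebraicFunOn ℚ (eC '' {P | P.pt ∈ U}) F ∧
      ∀ (P : AlgPoints C ℝ) (h : P.pt ∈ U), F (eC P) = P.eval U h f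
  /-- Coordinates of the real points of the Jacobian: `J(ℝ) → ℝ^N`. -/
  eJ : 𝒥.J.Points ℝ → (Fin N → ℝ)
  /-- `eJ` is a topological embedding (strong topology on `J(ℝ)`). -/
  isEmbedding_eJ : Topology.IsEmbedding eJ
  /-- `eJ (J(ℝ)) = R.pts`. -/
  range_eJ : Set.range eJ = R.pts
  /-- `eJ` carries the group law of `J(ℝ)` (written multiplicatively by Mathlib) to `R.add`. -/
  eJ_mul : ∀ P Q : 𝒥.J.Points ℝ, eJ (P * Q) = R.add (eJ P) (eJ Q)
  /-- The coordinates of `eJ` are regular functions on a Zariski open `V ⊆ J` containing every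
  real point, evaluated at the point. -/
  exists_eval_eq_eJ : ∃ (V : 𝒥.J.X.left.Opens) (f : Fin N → Γ(𝒥.J.X.left, V))
    (hV : ∀ P : 𝒥.J.Points ℝ, P.pt ∈ V), ∀ (P : 𝒥.J.Points ℝ) (j : Fin N), eJ P j = P.eval V (hV P) (f j)
  /-- Every regular function on a Zariski open `V ⊆ J` is, on `V(ℝ)`, a `ℚ`-semialgebraic function
  of the coordinates. -/
  exists_isSemialgebraicFunOn_eval_J : ∀ (V : 𝒥.J.X.left.Opens) (f : Γ(𝒥.J.X.left, V)),
    ∃ F : (Fin N → ℝ) → ℝ, IsSemialgebraicFunOn ℚ (eJ '' {P | P.pt ∈ V}) F ∧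
      ∀ (P : 𝒥.J.Points ℝ) (h : P.pt ∈ V), F (eJ P) = P.eval V h f
  /-- `eJ ∘ f^{P₀} = aj ∘ eC` on `C(ℝ)`: `R.aj` realises the canonical map `x ↦ [x − P₀]`. -/
  eJ_abelJacobi : ∀ P : AlgPoints C ℝ, eJ (AlgPoints.map (𝒥.abelJacobi P₀) P) = R.aj (eC P)

namespace Realization

variable {M N g : ℕ} {R : RealAbelJacobi M N g} {k : Type} [Field k] [Algebra k ℝ]
  {C : SchemeOver k} {P₀ : AlgPoints C k} {𝒥 : Jacobian C} (ρ : R.Realization C P₀ 𝒥)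

/-- Every coordinate vector `eJ P` lies in `R.pts`. [folklore] -/
theorem eJ_mem (P : 𝒥.J.Points ℝ) : ρ.eJ P ∈ R.pts :=
  ρ.range_eJ ▸ Set.mem_range_self P

/-- Every coordinate vector `eC P` lies in `R.C`. [folklore] -/
theorem eC_mem (P : AlgPoints C ℝ) : ρ.eC P ∈ R.C :=
  ρ.range_eC ▸ Set.mem_range_self P

/-- `eJ` sends the neutral element of `J(ℝ)` to `R.zero`. [folklore] -/
theorem eJ_one : ρ.eJ 1 = R.zero := by
  have h : R.add (ρ.eJ 1) (ρ.eJ 1) = R.add (ρ.eJ 1) R.zero := by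
    rw [← ρ.eJ_mul, mul_one, R.add_zero (ρ.eJ_mem 1)]
  exact R.add_left_cancel (ρ.eJ_mem 1) (ρ.eJ_mem 1) R.zero_mem h

/-- `eJ` sends inverses to `R.neg`. [folklore] -/
theorem eJ_inv (P : 𝒥.J.Points ℝ) : ρ.eJ P⁻¹ = R.neg (ρ.eJ P) := by
  have h : R.add (ρ.eJ P) (ρ.eJ P⁻¹) = R.add (ρ.eJ P) (R.neg (ρ.eJ P)) := by
    rw [← ρ.eJ_mul, mul_inv_cancel, ρ.eJ_one, R.add_neg_cancel (ρ.eJ_mem P)]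
  exact R.add_left_cancel (ρ.eJ_mem P) (ρ.eJ_mem _) (R.neg_mem (ρ.eJ_mem P)) h

/-- `eJ` is injective. [folklore] -/
theorem eJ_injective : Function.Injective ρ.eJ := ρ.isEmbedding_eJ.injective

/-- `eC` is injective. [folklore] -/
theorem eC_injective : Function.Injective ρ.eC := ρ.isEmbedding_eC.injective

/-- The real base point is mapped by `aj ∘ eC` to `0`, consistently with `f^{P₀}(P₀) = 0`
(`Jacobian.point_comp_abelJacobi`). [cite: Milne1986JacobianVarieties, §2] -/
theorem aj_eC_base : R.aj (ρ.eC (toSpecOver (specOver k ℝ) ≫ P₀)) = R.zero := by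
  rw [ρ.eC_base, R.aj_base]

end Realization

/-- **Existence of the real Abel–Jacobi package (named fact, not proved here).** Let `k ⊆ ℝ` be a
subfield all of whose elements are algebraic over `ℚ`, `C` a smooth projective geometrically
irreducible curve over `k` (`IsSmoothProjective 1 C`), `P₀ ∈ C(k)` and `𝒥` a Jacobian of `C`. Then
for some `M, N` there is a package `R : RealAbelJacobi M N (dim J)` with a `Realization` by
`(C, P₀, 𝒥)`. Assembly of classical facts: `J` is an abelian variety over `k ⊆ ℝ`, so `J(ℝ)` is
a compact commutative real Lie group of dimension `g = dim J` (Gross–Harris Prop. 1.1) and `C(ℝ)`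
a compact `1`-manifold; `J` and `C` are projective, and `ℝPⁿ ≅ G(n+1,1) ⊂ ℝ^{(n+1)²}`,
`x ↦ (xᵢxⱼ/|x|²)`, embeds their real points as compact real algebraic subsets with regular
coordinates (Akbulut–King Prop. 2.4.1, Cor. 2.4.2), nonsingular hence `C^∞` submanifolds with
regularly varying tangent planes (Akbulut–King Ch. II §§2–4, Prop. 2.4.3; BCR Prop. 3.3.11),
`k`-semialgebraic hence `ℚ`-semialgebraic (`k` real-algebraic); the group law and
`f^{P₀} : C → J` are `k`-morphisms (Milne §§1–2, Gross–Harris §2), hence continuous for the strong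
topology, Nash on real points, with `ℚ`-semialgebraic graphs (BCR Def. 2.2.5, Thm. 2.2.1), and
extend smoothly off the real loci (Lee, Lemma 2.26); the invariant differentials
`ω₁, …, ω_g` of `J` (Serre III.11, Prop. 16, Cor. 1), realified and composed with the orthogonal
projection onto the tangent planes, give the additive coframe (Serre III.11, Prop. 17, proof), and
`αᵢ = (f^{P₀})^*ωᵢ` are the differentials of the first kind (Serre V.10, Prop. 5, Cor. 1).
[cite: GrossHarris1981, §1 Prop. 1.1 and §2 (p. 159)] [cite: AkbulutKing1992, Ch. II §4, Prop. 2.4.1, Cor. 2.4.2, Prop. 2.4.3] [cite: Serre1988, Ch. III no. 11 (Prop. 16, Cor. 1, Prop. 17) and Ch. V no. 10 (Prop. 5, Cor. 1)] [cite: Milne1986JacobianVarieties, §1 Thm. 1.1 and §2] [cite: BochnakCosteRoy1998, Def. 2.2.5, Thm. 2.2.1, Prop. 3.3.11] [cite: LeeSmoothManifolds2013, Lemma 2.26] -/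
def exists_realization : Prop :=
  ∀ (k : Type) [Field k] [Algebra k ℝ], (∀ x : k, IsAlgebraic ℚ (algebraMap k ℝ x)) →
    ∀ (C : SchemeOver k), IsSmoothProjective 1 C → ∀ (P₀ : AlgPoints C k) (𝒥 : Jacobian C),
      ∃ (M N : ℕ) (R : RealAbelJacobi M N 𝒥.J.dim), Nonempty (R.Realization C P₀ 𝒥)

end RealAbelJacobi

end Literature.AlgebraicGeometry.RealAlgebraic

end
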